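import Summits.QuantumFields.YangMills.Theorems.BalabanUVNodesN19RateEdgeHolderD4AtRunsAlong
import Summits.QuantumFields.YangMills.Theorems.BalabanUVNodesSpineReadingOfRecord13CoPHV
import Summits.QuantumFields.YangMills.Theorems.BalabanUVNodesN19CoreEdgeFSCComposer

/-!
# BalabanUVNodes ∕ N19 — K3⁷'s N19′ SLOT UNDER THE `ForSmallCouplings` PREFIX AT dag-n20-d's V READING `crOfRecord₁₃VAt K₀ (jc …) sh`, MODULO THE SHORTEST LINK READING OF
# THIS SEAT's PROGRAMME — runs PINNED to the runs of record, (v′-17)'s β-window READ FROM K1⁷ along the runs, (ii-m) ON THE FAMILY's LATTICES, the volume sign definitional —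
# v9's clause minus TWENTY-TWO conjuncts (J 8 · AtRuns 7 · Along 2 · K 4 · vol 1); and the LITERAL PLUG into `HybridNE7Under` through this seat's FSC composer

Cell `pub-ymgap`, HUMAN RULING D-0062 (Track A) + D-0149 (work-bound push, director-ym №197), WIDTH SEAT `pub-ymgap-dag-n19-w3` (N19 NE7, seat 3 of 3), generation g2;
bus INTENT-8 (supersedes the announced INTENT-4 = `…D4AtRunsV` v1.1: the plug is typed HERE over the stronger AtRunsAlong face instead).  Cluster item K3⁷
«SpineGivenEndpointR13SepCoPH» (stmt-QuantumFields-20544), plan's skeleton v2 145a664ea9c38a7b ∕ v3 02f6f498332fdbee (N19′'s slot `KeyedCoreEdgeHolderD4 β cr (rrOfRecord 𝔯 ksel)`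
UNCHANGED in v3; v3's `PinnedAtLive (jc : CutReading) sh cr` names the witness `crOfRecord₁₃V (jc F θ hP g₀ os) sh = crOfRecord₁₃VAt 0 (jc …) sh` — this file's `K₀ := 0` case,
`crOfRecord₁₃V_eq` rfl); filed `--kind proof --supports` that item `--as helper` (it proves no registered stub).  COUNT-NEUTRAL.  THEOREMS ONLY; 0 `def`; 0 `sorry`;
`N`-generic, guard-generic `G`; NO Theses import.  Imports this seat's `…D4AtRunsAlong` (INTENT-7: the AtRuns face over E′ with the β-window along the runs) + `…N19CoreEdgeFSCComposer`
(INTENT-3: `keyedGuarded₁₃CoPH_of_fscCoreEdgeHolderD4_betaWindowPos`) and dag-n20-d's V edition `…SpineReadingOfRecord13CoPHV` (p590105) — CITED BY NAME, none edited; this seat's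
`…D4AtRunsV` (p594854) is the same edition over the weaker AtRuns face (its `hlink` still displays `0 < bβ ∧ EventualLowerH …`), kept as landed.

WHAT THIS FILE PROVES (`S := crOfRecord₁₃VAt K₀ (jc F θ hP g₀ os) sh F θ hP g₀ os`, `R := rateCarriersOfRecord₁₃CoPH 𝔯 F θ hP g₀ os k`, `D := datumOfRecord₁₃CoPH F N θ hP`).
* §1 ★★ `h19HolderD4_crOfRecord₁₃VAt_of_linkReadingAtRunsAlong_tuned` — on tuned bare sequences (`D.Tuned γ gIR g₀`, `γ ≤ θ.γ`) with `b ≤ β ≤ b′` along the runs of record,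
  `0 < b`: `PHolderD4 β D R` (spelled out) `→ ∃ δ, NE7.Core S.l₀ S.vol S.T S.Bad (S.A − S.shA) (S.B − S.shB) δ ∧ Summable δ`, MODULO `hlink` = INTENT-7's clause at `S` with K's
  (ii-m) pin and `0 ≤ S.vol` removed (INTENT-7 §1 at the reading `fun F θ hP g₀ os => crOfRecord₁₃VAt K₀ (jc …) sh …`, clause reassembled + `latticeLetters_family F Koff` +
  `pow_nonneg F.side_pos.le 4`) · ★ `core_crOfRecord₁₃VAt_of_linkReadingAtRunsAlong_tuned_of_shellWeightBound` (the reading's OWN canonical `S.δ`; PIN-N19-DELTAOFRECORD).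
* §2 ★★ `forSmallCouplings_h19HolderD4_crOfRecord₁₃VAt_of_linkReadingAtRunsAlong` — UNDER THE CRUX's PREFIX BY NAME from K1⁷'s `BetaBoundsInInterval D.C.toB12 γ₀ b b′`, `0 < b`
  (both halves read), threshold `min γ₀ θ.γ` · ★ `…_keyed`-shape `forSmallCouplings_keyedCoreEdgeHolderD4_crOfRecord₁₃VAt_of_linkReadingAtRunsAlong (ks)`.
* §3 ★★ `hybridNE7Under_datumOfRecord₁₃CoPH_of_linkReadingAtRunsAlongV` — THE LITERAL PLUG: from N20 ∕ N21 at `S` (leaf D's `h20`∕`h21` shapes), v2∕v3's ∀-`g₀` rates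
  `PHolderD4 β` (spelled out) at `rr := rateCarriersOfRecord₁₃CoPH 𝔯 … (ks …)`, leaf D's extraction clause `hx` at `S`, K1⁷'s window with `0 < b` at every guarded admissible tuple,
  AND THIS FILE's `hlink`: `HybridNE7Under (datumOfRecord₁₃CoPH F N θ hP) (EndpointExistence …)` at every guarded admissible tuple (composer `…_betaWindowPos` with `h19w := §2`).
  At `N = 2`, `G := θ.ZhUnity F 2 ∧ θ.SlotsNondegenerate₁₃ F 2` this is K3⁷'s conclusion as leaf D states it — MODULO `hlink` (NODE O's world at the runs of record, 0∕1
  inhabited), the other slots `h20`∕`h21`∕`hrates`∕`hx`, and K1⁷'s window.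
N19's displayed residual AT THE V READING UNDER THE PREFIX: NODE O's ledger world (i)∕(ii-m: `kappa₀ 64 8 ≤ R.u3.κ` + three `cells` clauses)∕(ii-v-A∕B)∕(ii-d) READ AT THE RUNS
OF RECORD, [III] Thm 2 (2.43) letters (N11), N14's positional count, the (v′-16) N16 ∕ N07 letters of `𝔯.lit`, the smallness window at the tuning radius and K1⁷'s `b`, `0 < ρ ≤ θc` (residual
`𝔯.lit.u3` letters), (T)'s `DecayBound` ∕ pair discs ∕ constants, the selector, `θ.γ² ≤ e⁻¹`.

HONEST FRAMING.  Count-neutral kernel bookkeeping; `hlink` is a HYPOTHESIS (NODE O's world; 0 instances in the tree); `D.Tuned` (K2⁷ ∕ [B12] Thm 2 content) and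
`BetaBoundsInInterval` + `0 < b` (K1⁷'s β-window at a world `w` — `BetaBoundsInInterval w.C.toB12 w.γ w.b w.βup` with `DagBinding.WorldP.b_pos : 0 < w.b`; lower half UNPRINTED T09.F, upper half [Balaban1987RG1] (1.22) p. 264 proof deferred) are HYPOTHESES; `hsh`, `h20`, `h21`,
`hrates`, `hx`, `hβw` HYPOTHESES; `K₀ jc sh 𝔯 G ks` PARAMETERS (`sh` NOT inhabited).  NOT a proof of K3⁷ or of any stub; no skeleton text touched.  NE7 for Bałaban's two runs is NOT
PRINTED and NOT proved; nothing of Bałaban's is asserted or instantiated (K0⁷ OPEN); N19 NOT discharged; K3⁷ NOT claimed; Track A count unmoved (typed 28∕28 · discharged 5∕27 ·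
A 5∕28).  One finite four-torus at fixed ε, rung (B)+1 — R4 closes the CONDITIONAL finite-𝕋⁴ rung `BalabanLadder.UV` only; NOT infinite volume, NOT OS on ℝ⁴, NOT a mass gap; the
YM mass gap (Clay) is NOT proved by any of this.  Standard axioms.  Supersedes nothing; edits nothing.  Shape reference: [Balaban1987RG1] Thm 2 p. 259 ∕ (0.31) (NAMES of hypotheses).
-/

set_option autoImplicit false

noncomputable section

open Finset MeasureTheory
open scoped BigOperators Matrix Matrix.Norms.L2Operator

namespace Summit.QuantumFields.YangMills.BalabanUVNodes.N19RateEdgeHolderD4AtRunsAlongV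

open Literature.MathematicalPhysics.QuantumFieldTheory.Balaban1983to89
open T4OutputRate T4RecentScale T4GoodClassBudget T4CauchySum T4TowerRateComposition T4TowerRateDischarge
open T4EtaRateMin (Readings NE3Shape)
open T4RateLiaison (GaugeDominated)
open T4CouplingMatching (EventualLowerH)
open FlowStep (RGEqH prefixOf)
open TreeLengthTorus (TFaceConnected torusTreeLen)
open B12TreeDecay (kappa₀)
open Summit.QuantumFields.BalabanUV.T4Continuum
open AveragingDeficitDualResidual (dualC1 dualC2)
open AveragingDeficitDerivWallProof (wallConst)
open AveragingDeficitPeriodicCounting (IsPeriodicDir)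
open MinimalActionSandwich (IsMinimiser minAct)
open MinimalActionRate (sfClass)
open MinimalActionRefine (RegularSup gradConst)
open NE3EnergyShapes (IsUnitarySite IsPeriodicSite)
open NE3.LeafIndexSockets (LeafH3sup)
open Summit.QuantumFields.BalabanUV.T4Continuum.Spine
open Summit.QuantumFields.BalabanUV.T4Continuum.Spine.NE4 (runFlow)
open Summit.QuantumFields.BalabanUV.T4Continuum.NE1p.DressedRoot (DressedTower DressedStabilityStrict)
open Summit.QuantumFields.YangMills.BalabanUVNodes.N19LedgerLinkSync (LedgerDataSync LedgerAtSync)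
open YMDAG.UVSplit (SpineCarriers SpineRecordPred InputsPred U3Carriers RateCarriers RateRecordPred N14At N18At N22At ReadOutAt)
open Summit.QuantumFields.YangMills.BalabanUVNodes.N16HolderDefs (CovRootHolder N16HolderAt)
open Summit.QuantumFields.YangMills.BalabanUVNodes.SpineRatesHolder (RatesHolderAt)
open Literature.MathematicalPhysics.QuantumFieldTheory.Balaban1983to89.T4Continuum (T4Family ULoop)
open T4WeightBudget (RelWeightBound)
open T4IndicatorShell (ShellWeightBound)
open T4ContinuumYM4Torus (ForSmallCouplings)
open YMDAG.UVSplit (Datum RateReading₁₃CoPH rateCarriersOfRecord₁₃CoPH)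
open YMDAG.UVSplit (SpineReading₁₃CoPH ShellSplit₁₃CoPH crOfRecord₁₃VAt classSet₁₃ weightA₁₃ weightB₁₃ badClass₁₃ core_crOfRecord₁₃VAt)
open Node00 (Stage13HParams datumOfRecord₁₃CoPH SiteSeqKey)
open Summit.QuantumFields.YangMills.BalabanUVNodes.SpineCanonicalWeights (core_nonneg_of_shellWeightBound)
open Summit.QuantumFields.YangMills.BalabanUVNodes.N19RateEdgeRecordRunLetters (latticeLetters_family)
open Summit.QuantumFields.YangMills.BalabanUVNodes.N19RateEdgeRecordRunLettersTuned (betaAlong_runFlow_le_of_betaBoundsInInterval)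
open Summit.QuantumFields.YangMills.BalabanUVNodes.N19RateEdgeHolderD4AtRunsAlong (h19HolderD4_datumOfRecord₁₃CoPH_of_linkReadingAtRunsAlong_tuned)
open Summit.QuantumFields.YangMills.BalabanUVNodes.N19InEdgesAlongRuns (alongLower_runFlow_of_tuned)
open Summit.QuantumFields.YangMills.BalabanUVNodes.N19CoreEdgeFSCComposer (keyedGuarded₁₃CoPH_of_fscCoreEdgeHolderD4_betaWindowPos)
open T4ApexHybrid (HybridNE7Under)

/-! ## §1 The link reading AT THE RUNS OF RECORD, AT THE V READING, on tuned bare sequences ⇒ N19′'s edge GIVEN `PHolderD4 β` -/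

section AtRunsAlongV

variable {N : ℕ} [NeZero N] (K₀ : ℕ)
  (jc : (F : T4Family) → (θ : Stage13HParams F N) → θ.Provisos₁₃CoPH F N → (ℕ → ℝ) → List (ULoop F) → ℕ → ℕ) (sh : ShellSplit₁₃CoPH N K₀)
  (𝔯 : RateReading₁₃CoPH N) (G : ∀ {F : T4Family}, Stage13HParams F N → Prop) {β : ℝ} (hβ1 : β ≤ 1)
  (hlink : ∀ (F : T4Family) (θ : Stage13HParams F N) (hP : θ.Provisos₁₃CoPH F N), G θ → θ.Admissible F N →
    ∀ (γ gIR b : ℝ) (g₀ : ℕ → ℝ), (datumOfRecord₁₃CoPH F N θ hP).Tuned γ gIR g₀ → γ ≤ θ.γ → 0 < b →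
    (∀ K m, 0 ≤ m → m < K → b ≤ (datumOfRecord₁₃CoPH F N θ hP).βfun m (prefixOf (runFlow (datumOfRecord₁₃CoPH F N θ hP) g₀ K) m)) →
    ∀ (os : List (ULoop F)) (k : ℕ),
      let S : SpineCarriers := crOfRecord₁₃VAt K₀ (jc F θ hP g₀ os) sh F θ hP g₀ os
      let R : RateCarriers N := rateCarriersOfRecord₁₃CoPH 𝔯 F θ hP g₀ os k
      let D : Datum F N := datumOfRecord₁₃CoPH F N θ hP
      letI := S.dec
      -- the tuple's window letter (replaces (T)'s clause over `R.u3.W`; dag-n19-w3 `window_rateCarriersOfRecord₁₃CoPH_sq_le_exp_neg_one`)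
      θ.γ ^ 2 ≤ Real.exp (-1) ∧
      ∃ (_ : DecidableEq R.u3.C.Dom) (F' : Type) (ι' X' : Type) (_ : MeasurableSpace ι')
        (L : LedgerDataSync R.u3.C F' ι' S.ι) (Rd : Readings ι' X') (bsel : (ℕ → ℝ) → ℝ) (EB : Functional R.u3.C R.u3.C.BgB)
        (θc θ₃ : ℝ) (g : ℕ → ℕ → ℝ)
        (uA : ℕ → ι' → R.u3.C.BgA) (uB : ℕ → ι' → R.u3.C.BgB)
        (Koff : ℕ) (cells : (K j : ℕ) → R.u3.C.Dom → Finset (Site (F.P (Koff + K)) j))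
        (H033 : Flow → ℕ → Prop) (I : Type) (fam : I → B14.Sect2Data) (Lb βw : ℝ) (κ₁ : ℕ) (Gv Cl : ℝ) (K₁ : ℕ)
        (Λ₀ N₀ : ℝ) (dressed : R.u3.C.Dom → Prop) (_ : DecidablePred dressed)
        -- N16-side letters: regime, selection, reading map, NE7 route-#1 side letters, offset
        (c' t ε₁ θ γ₃ l₁ : ℝ)
        (sel : ℕ → (B7Prop1Explicit.Site 4 → Fin 4 → (Matrix (Fin N) (Fin N) ℂ)ˣ) → (B7Prop1Explicit.Site 4 → Fin 4 → (Matrix (Fin N) (Fin N) ℂ)ˣ))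
        (rd : ι' → (B7Prop1Explicit.Site 4 → Fin 4 → (Matrix (Fin N) (Fin N) ℂ)ˣ)) (k₀ : ℕ)
        -- (N17-side letters: the infrared pin `gIR` is the TUNED value and the β-window is K1⁷'s lower constant `b` from scale 0 — no binders left)
        -- TUBE letters of the bracket (T): the (1.18) constant, the layer factor and (2.28)'s `C₁, q₁` (the flow's `β′_T` is no longer a binder)
        (E₀T κ₁T C₁T : ℝ) (q₁ : ℕ),
        -- ★ THE RUNS OF RECORD, window-extended by the infrared value: `g` IS `runFlow D g₀ K` up to the cutoff and `gIR` beyond (replaces the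
        -- (0.20)-run identification, the infrared pin, the box, both window memberships, (T)'s upper running and its sign `0 ≤ β′_T`)
        (∀ K i, i ≤ K → g K i = runFlow D g₀ K i) ∧ (∀ K i, K < i → g K i = gIR) ∧
        -- the run-B functional is the first-coupling family read through the selector
        EB = (fun s => R.u3.EB (bsel s) s) ∧
        -- (i) the ledger predicate for whatever size data and census constants meet their clauses
        (∀ (Sz : ℕ → ℝ → S.ι → ℕ → ℝ) (E₀ : ℝ) (m : ℕ) (a : ℝ) (Cw Λg : ℝ),
          (∀ K t, |t| ≤ S.l₀ → ∀ τ ∈ S.T K \ S.Bad K t, ∀ v ∈ Rd.dom, ∀ j ≤ K,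
            |∑ X ∈ L.fac K t τ with R.u3.C.scale X = j,
                (Real.log (Real.exp (EB (fun i => g (K + 1) (i + 1)) (uB K v) X
                    - EB (fun i => g (K + 1) (i + 1)) L.oneB X))
                  - Real.log (Real.exp (R.u3.EA (g K) (uA K v) X - R.u3.EA (g K) L.oneA X)))| ≤ Sz K t τ j) →
          0 ≤ E₀ → 0 < a → a < 1 →
          (∀ K t, |t| ≤ S.l₀ → ∀ τ ∈ S.T K \ S.Bad K t, ∀ j ≤ K,
            Sz K t τ j ≤ S.vol * (E₀ * ((K : ℝ) + 1) ^ m * a ^ (K - j))) →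
          (∀ K, Multiplicity (L.All K) R.u3.C.scale (fun X => Real.exp (-(R.u3.κ * R.u3.C.d X))) Cw S.vol Λg K) →
          (∀ K t, |t| ≤ S.l₀ → ∀ τ ∈ S.T K \ S.Bad K t,
            WindowMultiplicity (L.facO K t τ) L.scO L.wO Cw S.vol Λg (jlogOf L.Cl K) K) →
          1 ≤ Λg → L.θ' ≤ Λg →
          LedgerAtSync { L with S := Sz, E₀ := E₀, m := m, a := a, Cw := Cw, Λg := Λg } S.l₀ S.vol S.T S.Bad
            (fun K t τ => S.A K t τ - S.shA K t τ) (fun K t τ => S.B K t τ - S.shB K t τ) Rd R.u3.EA EB R.u3.κ g uA uB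
            R.u3.ω θc R.u3.θ θ₃) ∧
        -- (`0 ≤ S.vol` dropped: `S.vol = F.side ^ 4` by `rfl` at the V reading)
        (∀ K t, |t| ≤ S.l₀ → ∀ τ ∈ S.T K \ S.Bad K t,
          WindowMultiplicity (L.facO K t τ) L.scO L.wO L.Cw S.vol L.Λg (jlogOf L.Cl K) K) ∧
        0 ≤ L.Cw ∧ 1 ≤ L.Λg ∧ L.θ' ≤ L.Λg ∧
        -- (ii-m) the reference ledger ON THE FAMILY's OWN LATTICES (dag-n19-d's K: `Pf K := F.P (Koff + K)`, `d₀ := 4`, `L₀ := F.L`; the four lattice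
        -- clauses are `latticeLetters_family F Koff` at `S.vol = F.side ^ 4`): the decay threshold and NODE O's three `cells` clauses remain
        kappa₀ (4 * 2 ^ 4) (2 * 4) ≤ R.u3.κ ∧
        (∀ K, ∀ X ∈ L.All K,
          (cells K (R.u3.C.scale X + Koff) X).Nonempty ∧ TFaceConnected (cells K (R.u3.C.scale X + Koff) X)) ∧
        (∀ K j, Set.InjOn (cells K j) ↑((L.All K).filter fun X => R.u3.C.scale X + Koff = j)) ∧
        (∀ K, ∀ X ∈ L.All K, torusTreeLen (cells K (R.u3.C.scale X + Koff) X) ≤ R.u3.C.d X) ∧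
        -- (iii) [III] Theorem 2 (2.43) AS PRINTED with window letters
        B14.Thm2Printed H033 fam Lb βw κ₁ ∧ βw < 1 ∧ 0 < βw ∧ 1 < Lb ∧ 1 ≤ Gv ∧ 0 ≤ Cl ∧
        -- (iv) the positional-count half of N14's pinned pair at a rate `≤ R.ne1.Λ`
        (∀ p K, (R.ne1.𝒯.B p K).PositionalCount fun j k => N₀ * Λ₀ ^ (k - j)) ∧ 0 ≤ N₀ ∧ 0 ≤ Λ₀ ∧ Λ₀ ≤ R.ne1.Λ ∧
        -- (ii-v-A) run A's vacuum slices ↔ printed E-terms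
        (∀ K t, |t| ≤ S.l₀ → ∀ τ ∈ S.T K \ S.Bad K t, ∀ v ∈ Rd.dom, ∀ j ≤ K, ∃ (i : I) (w : (fam i).Ω) (j' : ℕ),
          (fam i).flow.SatisfiesRG (fam i).K ∧ H033 (fam i).flow (fam i).K ∧ 1 ≤ j' ∧ j' ≤ (fam i).K ∧
          (fam i).K - j' = K - j ∧ (fam i).K ≤ K + K₁ ∧
          (∀ n, 0 ≤ (fam i).gammaVol n w) ∧ (fam i).gammaVol (fam i).K w ≤ S.vol ∧
          (∀ n, n < (fam i).K → n < jlogOf Cl (fam i).K → (fam i).gammaVol n w = 0) ∧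
          (∀ n, n < (fam i).K → jlogOf Cl (fam i).K ≤ n → (fam i).gammaVol n w ≤ S.vol * Gv ^ ((fam i).K - n)) ∧
          |∑ X ∈ (L.fac K t τ).filter (fun X => ¬ dressed X) with R.u3.C.scale X = j,
              (R.u3.EA (g K) (uA K v) X - R.u3.EA (g K) L.oneA X)| ≤ |(fam i).eTerm j' (fam i).K w|) ∧
        -- (ii-v-B) run B's vacuum slices ↔ printed E-terms
        (∀ K t, |t| ≤ S.l₀ → ∀ τ ∈ S.T K \ S.Bad K t, ∀ v ∈ Rd.dom, ∀ j ≤ K, ∃ (i : I) (w : (fam i).Ω) (j' : ℕ),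
          (fam i).flow.SatisfiesRG (fam i).K ∧ H033 (fam i).flow (fam i).K ∧ 1 ≤ j' ∧ j' ≤ (fam i).K ∧
          (fam i).K - j' = K - j ∧ (fam i).K ≤ K + K₁ ∧
          (∀ n, 0 ≤ (fam i).gammaVol n w) ∧ (fam i).gammaVol (fam i).K w ≤ S.vol ∧
          (∀ n, n < (fam i).K → n < jlogOf Cl (fam i).K → (fam i).gammaVol n w = 0) ∧
          (∀ n, n < (fam i).K → jlogOf Cl (fam i).K ≤ n → (fam i).gammaVol n w ≤ S.vol * Gv ^ ((fam i).K - n)) ∧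
          |∑ X ∈ (L.fac K t τ).filter (fun X => ¬ dressed X) with R.u3.C.scale X = j,
              (EB (fun i => g (K + 1) (i + 1)) (uB K v) X - EB (fun i => g (K + 1) (i + 1)) L.oneB X)|
            ≤ |(fam i).eTerm j' (fam i).K w|) ∧
        -- (ii-d) the dressed sub-ledger ↔ N14's bookings on `R.ne1.𝒯`
        (∀ K t, |t| ≤ S.l₀ → ∀ τ ∈ S.T K \ S.Bad K t, ∀ v ∈ Rd.dom,
          ∃ (pA : R.ne1.P) (βA : R.u3.C.Dom → (R.ne1.𝒯.B pA K).Birth) (Q : Finset (R.ne1.𝒯.B pA K).Cube) (pB : R.ne1.P)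
            (KB : ℕ) (βB : R.u3.C.Dom → (R.ne1.𝒯.B pB KB).Birth),
          (∀ X ∈ (L.fac K t τ).filter (fun X => dressed X), (R.ne1.𝒯.B pA K).birthScale (βA X) = R.u3.C.scale X) ∧
          (∀ j, Set.InjOn βA ↑(((L.fac K t τ).filter (fun X => dressed X)).filter fun X => R.u3.C.scale X = j)) ∧
          (∀ c ∈ Q, (R.ne1.𝒯.B pA K).cubeScale c = K) ∧ ((Q.card : ℝ) ≤ S.vol) ∧
          (∀ X ∈ (L.fac K t τ).filter (fun X => dressed X), ∃ c ∈ Q, βA X ∈ (R.ne1.𝒯.B pA K).feltAt c) ∧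
          (∀ X ∈ (L.fac K t τ).filter (fun X => dressed X), KB - (R.ne1.𝒯.B pB KB).birthScale (βB X) = K - R.u3.C.scale X) ∧
          (∀ X ∈ (L.fac K t τ).filter (fun X => dressed X),
            |R.u3.EA (g K) (uA K v) X - R.u3.EA (g K) L.oneA X| ≤ (R.ne1.𝒯.B pA K).size (βA X) K) ∧
          (∀ X ∈ (L.fac K t τ).filter (fun X => dressed X),
            |EB (fun i => g (K + 1) (i + 1)) (uB K v) X - EB (fun i => g (K + 1) (i + 1)) L.oneB X|
              ≤ (R.ne1.𝒯.B pB KB).size (βB X) KB)) ∧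
        -- (v′-16) N16 BY NAME: THE END's regime letters of `R.ne3`, N07's interface, the selection, NE7 route-#1's side letters, the
        -- reading map, the action-reading identification, the offset, the gauge-domination convention
        R.ne3.g = gradConst 4 c' ∧ 1 ≤ R.ne3.Nper ∧ 0 ≤ R.ne3.b ∧ 0 ≤ c' ∧ R.ne3.b ≤ t ∧ c' ≤ t ∧ 0 ≤ R.ne3.C ∧
        (2 : ℝ) ^ 91 * (R.ne3.L : ℝ) ^ 17 * t ≤ 1 ∧ (2 : ℝ) ^ 76 * (R.ne3.L : ℝ) ^ 12 * t ≤ R.ne3.ε ∧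
        16 * B7Prop2Explicit.C0 4 * R.ne3.ε ≤ 3 ∧ 1024 * (4 + 1) * (4 + 4) * (R.ne3.L : ℝ) ^ 2 * R.ne3.ε ≤ 1 ∧
        ε₁ ≤ 1 / 4 ∧ ε₁ ≤ R.ne3.b ∧ 4 * ε₁ ≤ c' ∧ R.ne3.dom ⊆ sfClass 4 R.ne3.L R.ne3.Nper ε₁ 0 ∧
        LeafH3sup 4 R.ne3.L R.ne3.Nper R.ne3.ε R.ne3.b c' R.ne3.dom ∧
        (∀ V ∈ R.ne3.dom, ∀ k : ℕ, IsMinimiser 4 (sfClass 4 R.ne3.L R.ne3.Nper R.ne3.ε) R.ne3.L R.ne3.Nper k V (sel k V)) ∧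
        (∀ V ∈ R.ne3.dom, ∀ k : ℕ, RegularSup 4 R.ne3.L R.ne3.Nper R.ne3.b c' k (sel k V)) ∧
        0 < θ ∧ θ ^ 6 = ((R.ne3.L : ℝ))⁻¹ ∧ 0 < R.ne3.Λ₂' ∧ 0 < γ₃ ∧
        R.ne3.C * (wallConst 4 R.ne3.L * (R.ne3.Nper : ℝ) ^ 2 *
          (Real.sqrt (gradConst 4 c') * dualC2 4 R.ne3.L + 2 * R.ne3.b ^ 2 * dualC1 4 R.ne3.L)) ≤ γ₃ ^ 3 ∧
        0 < l₁ ∧ R.ne3.Λ₁ ≤ l₁ ^ 3 ∧ γ₃ * θ ^ 2 ≤ l₁ * R.ne3.Nper ∧ θ ^ ((3 : ℝ) * β - 2) ≤ θ₃ ∧ θ₃ < 1 ∧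
        (∀ v ∈ Rd.dom, rd v ∈ R.ne3.dom) ∧
        (∀ k, ∀ v ∈ Rd.dom, Rd.act k v = minAct 4 (sfClass 4 R.ne3.L R.ne3.Nper R.ne3.ε) R.ne3.L R.ne3.Nper k (rd v)) ∧
        (R.ne3.Nper : ℝ) ^ 4 ≤ Rd.vol ∧ 1 ≤ k₀ ∧
        (∀ K : ℕ, ∀ v ∈ Rd.dom, ∀ (u : B7Prop1Explicit.Site 4 → (Matrix (Fin N) (Fin N) ℂ)ˣ)
          (Z : B7Prop1Explicit.Site 4 → Fin 4 → Matrix (Fin N) (Fin N) ℂ) (M : ℝ),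
          IsUnitarySite u → IsPeriodicSite u ((R.ne3.Nper * R.ne3.L ^ (k₀ + K) : ℕ) : ℤ) → T4AveragingDeficitWall.IsSkewDir Z →
          IsPeriodicDir Z ((R.ne3.Nper * R.ne3.L ^ (k₀ + K) : ℕ) : ℤ) →
          B7Prop1Explicit.gaugeAct u (sel (k₀ + K) (rd v)) =
            T4AveragingDeficitWall.vary (B7Prop2Explicit.rescale R.ne3.L (B7Prop1Explicit.bavg R.ne3.L (sel (k₀ + K + 1) (rd v)))) Z 1 →
          (∀ (x : B7Prop1Explicit.Site 4) (κ : Fin 4), (R.ne3.L : ℝ) ^ (k₀ + K) * ‖Z x κ‖ ≤ M) →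
          (∀ (x : B7Prop1Explicit.Site 4) (μ κ : Fin 4), ((R.ne3.L : ℝ) ^ (k₀ + K)) ^ 2 *
              ‖T4AveragingDeficitWall.Ad (B7Prop2Explicit.rescale R.ne3.L (B7Prop1Explicit.bavg R.ne3.L (sel (k₀ + K + 1) (rd v)))
                  (x + B7Prop1Explicit.e κ) μ) (Z (x + B7Prop1Explicit.e μ) κ) - Z x κ‖ ≤ M) →
          R.u3.C.gauge (uA K v) (R.u3.C.transport (uB K v)) ≤ M) ∧
        -- (v′-17) N17 BY NAME, what is left of it: the smallness window AT THE TUNING RADIUS `γ` and K1⁷'s `b` from scale 0, rates (run identification ∕ infrared pin ∕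
        -- box are the pin's, the β-window is K1⁷'s)
        R.u3.cr * R.u3.C₉ * R.u3.ω * (γ ^ 3 + 2 * γ / b) ≤ (1 - R.u3.ρ) / 2 ∧
        0 < R.u3.ρ ∧ R.u3.ρ ≤ θc ∧
        -- the bracket (T) IN THE TUBE CURRENCY, what is left of it: the (1.18) real bound; the pair-disc shape at the printed tube radius κ₁·α(C₁, q₁, s_j)
        -- ((2.27)(ii)(iv) through the (1.13)∕(2.39) tube — SHAPE, NODE O); signs (the upper running and both window memberships are the pin's)
        DecayBound R.u3.EA R.u3.W E₀T R.u3.κ ∧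
        (∀ s ∈ R.u3.W, ∀ (X : R.u3.C.Dom) (U U' : R.u3.C.BgA),
          R.u3.C.gauge U U' < κ₁T * B14.alphaJ C₁T q₁ (s (R.u3.C.scale X)) →
          ∃ f : ℂ → ℂ, DifferentiableOn ℂ f (Metric.ball (0 : ℂ) (κ₁T * B14.alphaJ C₁T q₁ (s (R.u3.C.scale X)))) ∧
            f 0 = (R.u3.EA s U X : ℂ) ∧ f (R.u3.C.gauge U U' : ℂ) = (R.u3.EA s U' X : ℂ) ∧
            ∀ z ∈ Metric.ball (0 : ℂ) (κ₁T * B14.alphaJ C₁T q₁ (s (R.u3.C.scale X))),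
              ‖f z‖ ≤ E₀T * Real.exp (-(R.u3.κ * R.u3.C.d X))) ∧
        0 ≤ E₀T ∧ 0 < κ₁T ∧ 0 < C₁T ∧
        -- selector compatibility
        (∀ s ∈ R.u3.W, 0 < bsel s ∧ bsel s ≤ R.u3.γ))


include hβ1 hlink

/-- ★★ **N19′'s EDGE AT THE V READING, ON TUNED BARE SEQUENCES, MODULO THE SHORTEST LINK READING SO FAR** [bookkeeping]: at every guarded admissible Stage-13 tuple, every
bare sequence `g₀` TUNED to `gIR` within `]0, γ]`, `γ ≤ θ.γ` (HYPOTHESIS, [Balaban1987RG1] Thm 2 p. 259's condition at the datum of record), with `β ≤ b′` ALONG ITS RUNS OF RECORD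
(K1⁷'s window; HYPOTHESIS), every `os`, `k`: `PHolderD4 β D R` (spelled out) `→ ∃ δ, NE7.Core S.l₀ S.vol S.T S.Bad (S.A − S.shA) (S.B − S.shB) δ ∧ Summable δ` for
`S := crOfRecord₁₃VAt K₀ (jc F θ hP g₀ os) sh F θ hP g₀ os`.  Proof: this seat's AtRuns §2 at `cr := fun F θ hP g₀ os => crOfRecord₁₃VAt K₀ (jc F θ hP g₀ os) sh F θ hP g₀ os`, its clause REASSEMBLED from `hlink` + the four lattice facts
`latticeLetters_family F Koff` (dag-n19-d's K pattern) + the volume sign `0 ≤ F.side ^ 4`.  NOT NE7; N19 NOT discharged; `hlink` DISPLAYED. -/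
theorem h19HolderD4_crOfRecord₁₃VAt_of_linkReadingAtRunsAlong_tuned
    (F : T4Family) (θ : Stage13HParams F N) (hP : θ.Provisos₁₃CoPH F N) (hG : G θ) (hθ : θ.Admissible F N) {γ gIR b' : ℝ} {g₀ : ℕ → ℝ}
    (ht : (datumOfRecord₁₃CoPH F N θ hP).Tuned γ gIR g₀) (hγle : γ ≤ θ.γ) {b : ℝ} (hb0 : 0 < b)
    (hlow : ∀ K m, 0 ≤ m → m < K →
      b ≤ (datumOfRecord₁₃CoPH F N θ hP).βfun m (prefixOf (runFlow (datumOfRecord₁₃CoPH F N θ hP) g₀ K) m))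
    (halong : ∀ K i, i < K →
      (datumOfRecord₁₃CoPH F N θ hP).βfun i (prefixOf (runFlow (datumOfRecord₁₃CoPH F N θ hP) g₀ K) i) ≤ b')
    (os : List (ULoop F)) (k : ℕ)
    (hP4 : RatesHolderAt (datumOfRecord₁₃CoPH F N θ hP) (rateCarriersOfRecord₁₃CoPH 𝔯 F θ hP g₀ os k) β ∧
      ReadOutAt (datumOfRecord₁₃CoPH F N θ hP) (rateCarriersOfRecord₁₃CoPH 𝔯 F θ hP g₀ os k).u3 ∧
      (0 ≤ (rateCarriersOfRecord₁₃CoPH 𝔯 F θ hP g₀ os k).u3.ρ ∧ (rateCarriersOfRecord₁₃CoPH 𝔯 F θ hP g₀ os k).u3.ρ < 1)) :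
    letI := (crOfRecord₁₃VAt K₀ (jc F θ hP g₀ os) sh F θ hP g₀ os).dec
    ∃ δ : ℕ → ℝ, NE7.Core (crOfRecord₁₃VAt K₀ (jc F θ hP g₀ os) sh F θ hP g₀ os).l₀ (crOfRecord₁₃VAt K₀ (jc F θ hP g₀ os) sh F θ hP g₀ os).vol (crOfRecord₁₃VAt K₀ (jc F θ hP g₀ os) sh F θ hP g₀ os).T
      (crOfRecord₁₃VAt K₀ (jc F θ hP g₀ os) sh F θ hP g₀ os).Bad
      (fun K t τ => (crOfRecord₁₃VAt K₀ (jc F θ hP g₀ os) sh F θ hP g₀ os).A K t τ - (crOfRecord₁₃VAt K₀ (jc F θ hP g₀ os) sh F θ hP g₀ os).shA K t τ)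
      (fun K t τ => (crOfRecord₁₃VAt K₀ (jc F θ hP g₀ os) sh F θ hP g₀ os).B K t τ - (crOfRecord₁₃VAt K₀ (jc F θ hP g₀ os) sh F θ hP g₀ os).shB K t τ) δ ∧
      Summable δ := by
  refine h19HolderD4_datumOfRecord₁₃CoPH_of_linkReadingAtRunsAlong_tuned (fun F θ hP g₀ os => crOfRecord₁₃VAt K₀ (jc F θ hP g₀ os) sh F θ hP g₀ os) 𝔯 G hβ1 ?_
    F θ hP hG hθ ht hγle hb0 hlow halong os k hP4
  intro F θ hP hG hθ γ gIR b g₀ ht hγle hb0 hlow os k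
  -- destructure this file's reading IN STAGES, then reassemble the AtRunsAlong clause with the (ii-m) letters pinned to the family and the volume sign supplied
  obtain ⟨hγe, iDom, F', ι', X', iMeas, L, Rd, bsel, EB, θc, θ₃, g, uA, uB, hrest⟩ := hlink F θ hP hG hθ γ gIR b g₀ ht hγle hb0 hlow os k
  obtain ⟨Koff, cells, H033, I, fam, Lb, βw, κ₁, Gv, Cl, K₁, Λ₀, N₀, dressed, iDr, hrest⟩ := hrest
  obtain ⟨c', t, ε₁, ϑ, γ₃, l₁, sel, rd, k₀, E₀T, κ₁T, C₁T, q₁, hrest⟩ := hrest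
  obtain ⟨hgle, hggt, hEB, hL, homult, hCw, hΛg, hθΛ, hκ₀, hdom, hinj, hlen, hrest⟩ := hrest
  obtain ⟨hPd, hPL, hPK, hcard⟩ := latticeLetters_family F Koff
  have hvol : (0 : ℝ) ≤ (crOfRecord₁₃VAt K₀ (jc F θ hP g₀ os) sh F θ hP g₀ os).vol := pow_nonneg F.side_pos.le 4
  exact ⟨hγe, iDom, F', ι', X', iMeas, L, Rd, bsel, EB, θc, θ₃, g, uA, uB, fun K => F.P (Koff + K), 4, F.L, Koff, cells, H033, I, fam, Lb, βw, κ₁, Gv, Cl, K₁,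
    Λ₀, N₀, dressed, iDr, c', t, ε₁, ϑ, γ₃, l₁, sel, rd, k₀, E₀T, κ₁T, C₁T, q₁, hgle, hggt, hEB, hL, hvol, homult, hCw, hΛg, hθΛ, hPd, hPL, hPK,
    hcard, hκ₀, hdom, hinj, hlen, hrest⟩

/-- ★ **… WITH THE READING's OWN CANONICAL RATE** (sign from any shell witness — dag-n20-d `core_nonneg_of_shellWeightBound`, transfer `core_crOfRecord₁₃VAt`):
`NE7.Core S.l₀ S.vol S.T S.Bad (S.A − S.shA) (S.B − S.shB) S.δ ∧ Summable S.δ` on tuned bare sequences; `Summable S.δ` a COROLLARY of the edge (ref-B PIN-N19-DELTAOFRECORD). [folklore] -/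
theorem core_crOfRecord₁₃VAt_of_linkReadingAtRunsAlong_tuned_of_shellWeightBound
    (F : T4Family) (θ : Stage13HParams F N) (hP : θ.Provisos₁₃CoPH F N) (hG : G θ) (hθ : θ.Admissible F N) {γ gIR b' : ℝ} {g₀ : ℕ → ℝ}
    (ht : (datumOfRecord₁₃CoPH F N θ hP).Tuned γ gIR g₀) (hγle : γ ≤ θ.γ) {b : ℝ} (hb0 : 0 < b)
    (hlow : ∀ K m, 0 ≤ m → m < K →
      b ≤ (datumOfRecord₁₃CoPH F N θ hP).βfun m (prefixOf (runFlow (datumOfRecord₁₃CoPH F N θ hP) g₀ K) m))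
    (halong : ∀ K i, i < K →
      (datumOfRecord₁₃CoPH F N θ hP).βfun i (prefixOf (runFlow (datumOfRecord₁₃CoPH F N θ hP) g₀ K) i) ≤ b')
    (os : List (ULoop F)) (k : ℕ)
    (hP4 : RatesHolderAt (datumOfRecord₁₃CoPH F N θ hP) (rateCarriersOfRecord₁₃CoPH 𝔯 F θ hP g₀ os k) β ∧
      ReadOutAt (datumOfRecord₁₃CoPH F N θ hP) (rateCarriersOfRecord₁₃CoPH 𝔯 F θ hP g₀ os k).u3 ∧
      (0 ≤ (rateCarriersOfRecord₁₃CoPH 𝔯 F θ hP g₀ os k).u3.ρ ∧ (rateCarriersOfRecord₁₃CoPH 𝔯 F θ hP g₀ os k).u3.ρ < 1)) {Wsh : ℕ → ℝ}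
    (hsh : ShellWeightBound 1 (classSet₁₃ θ K₀ g₀) (weightA₁₃ θ hP K₀ g₀ os) (weightB₁₃ θ hP K₀ g₀ os) (sh F θ hP g₀ os).1 (sh F θ hP g₀ os).2 Wsh) :
    (letI := (crOfRecord₁₃VAt K₀ (jc F θ hP g₀ os) sh F θ hP g₀ os).dec
     NE7.Core (crOfRecord₁₃VAt K₀ (jc F θ hP g₀ os) sh F θ hP g₀ os).l₀ (crOfRecord₁₃VAt K₀ (jc F θ hP g₀ os) sh F θ hP g₀ os).vol (crOfRecord₁₃VAt K₀ (jc F θ hP g₀ os) sh F θ hP g₀ os).T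
       (crOfRecord₁₃VAt K₀ (jc F θ hP g₀ os) sh F θ hP g₀ os).Bad
       (fun K t τ => (crOfRecord₁₃VAt K₀ (jc F θ hP g₀ os) sh F θ hP g₀ os).A K t τ - (crOfRecord₁₃VAt K₀ (jc F θ hP g₀ os) sh F θ hP g₀ os).shA K t τ)
       (fun K t τ => (crOfRecord₁₃VAt K₀ (jc F θ hP g₀ os) sh F θ hP g₀ os).B K t τ - (crOfRecord₁₃VAt K₀ (jc F θ hP g₀ os) sh F θ hP g₀ os).shB K t τ)
       (crOfRecord₁₃VAt K₀ (jc F θ hP g₀ os) sh F θ hP g₀ os).δ) ∧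
      Summable (crOfRecord₁₃VAt K₀ (jc F θ hP g₀ os) sh F θ hP g₀ os).δ := by
  obtain ⟨δ, hcore, hsum⟩ :=
    h19HolderD4_crOfRecord₁₃VAt_of_linkReadingAtRunsAlong_tuned K₀ jc sh 𝔯 G hβ1 hlink F θ hP hG hθ ht hγle hb0 hlow halong os k hP4
  letI : DecidableEq (Σ K, SiteSeqKey F (K₀ + K)) := Classical.decEq _
  exact core_crOfRecord₁₃VAt K₀ (jc F θ hP g₀ os) sh θ hP g₀ os (core_nonneg_of_shellWeightBound hsh) hcore hsum

/-! ## §2 UNDER THE CRUX's PREFIX BY NAME, AT THE V READING -/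

/-- ★★ **N19′'s SLOT UNDER THE `ForSmallCouplings` PREFIX AT THE V READING, MODULO THE SHORTEST LINK READING SO FAR** [bookkeeping]: at every guarded admissible tuple
carrying K1⁷'s interval-form β-window `BetaBoundsInInterval D.C.toB12 γ₀ b b′` (N24's binder; HYPOTHESIS): FOR ALL SMALL COUPLINGS (threshold `min γ₀ θ.γ`, `g`-threshold
idle; `ForSmallCouplings` BY NAME) every `os k`: `PHolderD4 β D R → ∃ δ, NE7.Core S … δ ∧ Summable δ` at `S := crOfRecord₁₃VAt K₀ (jc F θ hP g₀ os) sh F θ hP g₀ os`.  (B) and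
`EndpointExistence` not used.  NOT NE7; N19 NOT discharged; NOT a proof of `stub_expansion13H`. -/
theorem forSmallCouplings_h19HolderD4_crOfRecord₁₃VAt_of_linkReadingAtRunsAlong
    (F : T4Family) (θ : Stage13HParams F N) (hP : θ.Provisos₁₃CoPH F N) (hG : G θ) (hθ : θ.Admissible F N) {γ₀ b b' : ℝ} (hγ₀ : 0 < γ₀) (hb0 : 0 < b)
    (hβ : DagBinding.BetaBoundsInInterval (datumOfRecord₁₃CoPH F N θ hP).C.toB12 γ₀ b b') :
    ForSmallCouplings (datumOfRecord₁₃CoPH F N θ hP) fun g₀ => ∀ (os : List (ULoop F)) (k : ℕ),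
      (RatesHolderAt (datumOfRecord₁₃CoPH F N θ hP) (rateCarriersOfRecord₁₃CoPH 𝔯 F θ hP g₀ os k) β ∧
        ReadOutAt (datumOfRecord₁₃CoPH F N θ hP) (rateCarriersOfRecord₁₃CoPH 𝔯 F θ hP g₀ os k).u3 ∧
        (0 ≤ (rateCarriersOfRecord₁₃CoPH 𝔯 F θ hP g₀ os k).u3.ρ ∧ (rateCarriersOfRecord₁₃CoPH 𝔯 F θ hP g₀ os k).u3.ρ < 1)) →
      letI := (crOfRecord₁₃VAt K₀ (jc F θ hP g₀ os) sh F θ hP g₀ os).dec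
      ∃ δ : ℕ → ℝ, NE7.Core (crOfRecord₁₃VAt K₀ (jc F θ hP g₀ os) sh F θ hP g₀ os).l₀ (crOfRecord₁₃VAt K₀ (jc F θ hP g₀ os) sh F θ hP g₀ os).vol (crOfRecord₁₃VAt K₀ (jc F θ hP g₀ os) sh F θ hP g₀ os).T
        (crOfRecord₁₃VAt K₀ (jc F θ hP g₀ os) sh F θ hP g₀ os).Bad
        (fun K t τ => (crOfRecord₁₃VAt K₀ (jc F θ hP g₀ os) sh F θ hP g₀ os).A K t τ - (crOfRecord₁₃VAt K₀ (jc F θ hP g₀ os) sh F θ hP g₀ os).shA K t τ)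
        (fun K t τ => (crOfRecord₁₃VAt K₀ (jc F θ hP g₀ os) sh F θ hP g₀ os).B K t τ - (crOfRecord₁₃VAt K₀ (jc F θ hP g₀ os) sh F θ hP g₀ os).shB K t τ) δ ∧
        Summable δ := by
  refine ⟨min γ₀ θ.γ, lt_min hγ₀ hθ.toStage9.gamma_pos, fun γ _ hγle => ⟨1, one_pos, fun gIR _ _ g₀ ht os k hP4 => ?_⟩⟩
  exact h19HolderD4_crOfRecord₁₃VAt_of_linkReadingAtRunsAlong_tuned K₀ jc sh 𝔯 G hβ1 hlink F θ hP hG hθ ht (hγle.trans (min_le_right _ _)) hb0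
    (alongLower_runFlow_of_tuned _ hβ (hγle.trans (min_le_left _ _)) ht)
    (fun K i hi => betaAlong_runFlow_le_of_betaBoundsInInterval _ hβ (hγle.trans (min_le_left _ _)) (ht K).1 i hi) os k hP4

/-- ★ **THE v2 SLOT TEXT AT THE V READING UNDER THE PREFIX** (`KeyedCoreEdgeHolderD4 β cr (rrOfRecord 𝔯 ks)`'s `g₀ os`-clause at `cr := fun F θ hP g₀ os =>
crOfRecord₁₃VAt K₀ (jc F θ hP g₀ os) sh F θ hP g₀ os`, unfolded, restricted to `ForSmallCouplings`; `K₀ := 0`, constant `jc` is K's `crOfRecord₁₃V jcut sh`): §2 at `k := ks F θ hP g₀ os` (`.mono`).  NOT a proof of stub 2. [folklore] -/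
theorem forSmallCouplings_keyedCoreEdgeHolderD4_crOfRecord₁₃VAt_of_linkReadingAtRunsAlong
    (ks : (F : T4Family) → (θ : Stage13HParams F N) → θ.Provisos₁₃CoPH F N → (ℕ → ℝ) → List (ULoop F) → ℕ)
    (F : T4Family) (θ : Stage13HParams F N) (hP : θ.Provisos₁₃CoPH F N) (hG : G θ) (hθ : θ.Admissible F N) {γ₀ b b' : ℝ} (hγ₀ : 0 < γ₀) (hb0 : 0 < b)
    (hβ : DagBinding.BetaBoundsInInterval (datumOfRecord₁₃CoPH F N θ hP).C.toB12 γ₀ b b') :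
    ForSmallCouplings (datumOfRecord₁₃CoPH F N θ hP) fun g₀ => ∀ (os : List (ULoop F)),
      (RatesHolderAt (datumOfRecord₁₃CoPH F N θ hP) (rateCarriersOfRecord₁₃CoPH 𝔯 F θ hP g₀ os (ks F θ hP g₀ os)) β ∧
        ReadOutAt (datumOfRecord₁₃CoPH F N θ hP) (rateCarriersOfRecord₁₃CoPH 𝔯 F θ hP g₀ os (ks F θ hP g₀ os)).u3 ∧
        (0 ≤ (rateCarriersOfRecord₁₃CoPH 𝔯 F θ hP g₀ os (ks F θ hP g₀ os)).u3.ρ ∧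
          (rateCarriersOfRecord₁₃CoPH 𝔯 F θ hP g₀ os (ks F θ hP g₀ os)).u3.ρ < 1)) →
      letI := (crOfRecord₁₃VAt K₀ (jc F θ hP g₀ os) sh F θ hP g₀ os).dec
      ∃ δ : ℕ → ℝ, NE7.Core (crOfRecord₁₃VAt K₀ (jc F θ hP g₀ os) sh F θ hP g₀ os).l₀ (crOfRecord₁₃VAt K₀ (jc F θ hP g₀ os) sh F θ hP g₀ os).vol (crOfRecord₁₃VAt K₀ (jc F θ hP g₀ os) sh F θ hP g₀ os).T
        (crOfRecord₁₃VAt K₀ (jc F θ hP g₀ os) sh F θ hP g₀ os).Bad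
        (fun K t τ => (crOfRecord₁₃VAt K₀ (jc F θ hP g₀ os) sh F θ hP g₀ os).A K t τ - (crOfRecord₁₃VAt K₀ (jc F θ hP g₀ os) sh F θ hP g₀ os).shA K t τ)
        (fun K t τ => (crOfRecord₁₃VAt K₀ (jc F θ hP g₀ os) sh F θ hP g₀ os).B K t τ - (crOfRecord₁₃VAt K₀ (jc F θ hP g₀ os) sh F θ hP g₀ os).shB K t τ) δ ∧
        Summable δ :=
  (forSmallCouplings_h19HolderD4_crOfRecord₁₃VAt_of_linkReadingAtRunsAlong K₀ jc sh 𝔯 G hβ1 hlink F θ hP hG hθ hγ₀ hb0 hβ).mono fun g₀ h os =>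
    h os (ks F θ hP g₀ os)

/-! ## §3 THE LITERAL PLUG: K3⁷'s conclusion at every guarded admissible tuple from v2∕v3's other faces, THIS reading under the prefix, K1⁷'s window -/

/-- ★★ **THE PLUG AT THE V READING, β-WINDOW FROM K1⁷** [bookkeeping]: with `S := crOfRecord₁₃VAt K₀ (jc F θ hP g₀ os) sh F θ hP g₀ os` as the spine reading and
`rr := rateCarriersOfRecord₁₃CoPH 𝔯 … (ks …)`, from N20 ∕ N21 at `S` (leaf D's `h20`∕`h21` shapes; dag-n20-d's `relWeightBound_∕shellWeightBound_crOfRecord₁₃VAt` are their by-name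
faces), v2's ∀-`g₀` rates `PHolderD4 β` (spelled out), leaf D's extraction clause `hx` at `S` (dag-n20-d's `keyedExtraction_crOfRecord₁₃VAt` on the live line — dag-n19-d's H∕G′
pattern, not composed here), K1⁷'s interval-form β-window at every guarded admissible tuple (`hβw`), AND THIS FILE's link reading `hlink` (section hypothesis): `HybridNE7Under
(datumOfRecord₁₃CoPH F N θ hP) (EndpointExistence …)` at every guarded admissible tuple — this seat's composer `N19CoreEdgeFSCComposer.keyedGuarded₁₃CoPH_of_fscCoreEdgeHolderD4_betaWindowPos`
with `h19w := forSmallCouplings_keyedCoreEdgeHolderD4_crOfRecord₁₃VAt_of_linkReadingAtRunsAlong` (§2).  At `N = 2`, `G := θ.ZhUnity F 2 ∧ θ.SlotsNondegenerate₁₃ F 2` the conclusion is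
K3⁷'s as leaf D states it — MODULO `hlink` (NODE O's world at the runs of record, 0∕1 inhabited), `h20`∕`h21`∕`hrates`∕`hx` (the other slots of v2) and K1⁷'s window.  NOT a proof
of K3⁷ or of any stub; N19 NOT discharged. -/
theorem hybridNE7Under_datumOfRecord₁₃CoPH_of_linkReadingAtRunsAlongV
    (ks : (F : T4Family) → (θ : Stage13HParams F N) → θ.Provisos₁₃CoPH F N → (ℕ → ℝ) → List (ULoop F) → ℕ)
    (h20 : ∀ (F : T4Family) (θ : Stage13HParams F N) (hP : θ.Provisos₁₃CoPH F N), G θ → θ.Admissible F N → ∀ (g₀ : ℕ → ℝ) (os : List (ULoop F)),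
      RelWeightBound (crOfRecord₁₃VAt K₀ (jc F θ hP g₀ os) sh F θ hP g₀ os).l₀ (crOfRecord₁₃VAt K₀ (jc F θ hP g₀ os) sh F θ hP g₀ os).T
        (crOfRecord₁₃VAt K₀ (jc F θ hP g₀ os) sh F θ hP g₀ os).A (crOfRecord₁₃VAt K₀ (jc F θ hP g₀ os) sh F θ hP g₀ os).B
        (crOfRecord₁₃VAt K₀ (jc F θ hP g₀ os) sh F θ hP g₀ os).Bad (crOfRecord₁₃VAt K₀ (jc F θ hP g₀ os) sh F θ hP g₀ os).W)
    (h21 : ∀ (F : T4Family) (θ : Stage13HParams F N) (hP : θ.Provisos₁₃CoPH F N), G θ → θ.Admissible F N → ∀ (g₀ : ℕ → ℝ) (os : List (ULoop F)),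
      ShellWeightBound (crOfRecord₁₃VAt K₀ (jc F θ hP g₀ os) sh F θ hP g₀ os).l₀ (crOfRecord₁₃VAt K₀ (jc F θ hP g₀ os) sh F θ hP g₀ os).T
        (crOfRecord₁₃VAt K₀ (jc F θ hP g₀ os) sh F θ hP g₀ os).A (crOfRecord₁₃VAt K₀ (jc F θ hP g₀ os) sh F θ hP g₀ os).B
        (crOfRecord₁₃VAt K₀ (jc F θ hP g₀ os) sh F θ hP g₀ os).shA (crOfRecord₁₃VAt K₀ (jc F θ hP g₀ os) sh F θ hP g₀ os).shB
        (crOfRecord₁₃VAt K₀ (jc F θ hP g₀ os) sh F θ hP g₀ os).Wsh)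
    (hrates : ∀ (F : T4Family) (θ : Stage13HParams F N) (hP : θ.Provisos₁₃CoPH F N), G θ → θ.Admissible F N → ∀ (g₀ : ℕ → ℝ) (os : List (ULoop F)),
      RatesHolderAt (datumOfRecord₁₃CoPH F N θ hP) (rateCarriersOfRecord₁₃CoPH 𝔯 F θ hP g₀ os (ks F θ hP g₀ os)) β ∧
        ReadOutAt (datumOfRecord₁₃CoPH F N θ hP) (rateCarriersOfRecord₁₃CoPH 𝔯 F θ hP g₀ os (ks F θ hP g₀ os)).u3 ∧
        (0 ≤ (rateCarriersOfRecord₁₃CoPH 𝔯 F θ hP g₀ os (ks F θ hP g₀ os)).u3.ρ ∧ (rateCarriersOfRecord₁₃CoPH 𝔯 F θ hP g₀ os (ks F θ hP g₀ os)).u3.ρ < 1))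
    (hβw : ∀ (F : T4Family) (θ : Stage13HParams F N) (hP : θ.Provisos₁₃CoPH F N), G θ → θ.Admissible F N →
      ∃ γ₀ b b' : ℝ, 0 < γ₀ ∧ 0 < b ∧ DagBinding.BetaBoundsInInterval (datumOfRecord₁₃CoPH F N θ hP).C.toB12 γ₀ b b')
    (hx : ∀ (F : T4Family) (θ : Stage13HParams F N) (hP : θ.Provisos₁₃CoPH F N), G θ → θ.Admissible F N →
      B16.EndStatementBPrinted (datumOfRecord₁₃CoPH F N θ hP).C → DagBinding.EndpointExistence (datumOfRecord₁₃CoPH F N θ hP).C.toB12 →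
        ForSmallCouplings (datumOfRecord₁₃CoPH F N θ hP) fun g₀ => ∀ os : List (ULoop F),
          0 < (crOfRecord₁₃VAt K₀ (jc F θ hP g₀ os) sh F θ hP g₀ os).l₀ ∧ 0 < (crOfRecord₁₃VAt K₀ (jc F θ hP g₀ os) sh F θ hP g₀ os).vol ∧
          (∀ (K : ℕ) (t : ℝ), |t| ≤ (crOfRecord₁₃VAt K₀ (jc F θ hP g₀ os) sh F θ hP g₀ os).l₀ →
            T4GenFunBounds.schemeZ ((datumOfRecord₁₃CoPH F N θ hP).scheme g₀) os ((crOfRecord₁₃VAt K₀ (jc F θ hP g₀ os) sh F θ hP g₀ os).K₀ + K) t =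
              ∑ τ ∈ (crOfRecord₁₃VAt K₀ (jc F θ hP g₀ os) sh F θ hP g₀ os).T K, (crOfRecord₁₃VAt K₀ (jc F θ hP g₀ os) sh F θ hP g₀ os).A K t τ) ∧
          (∀ (K : ℕ) (t : ℝ), |t| ≤ (crOfRecord₁₃VAt K₀ (jc F θ hP g₀ os) sh F θ hP g₀ os).l₀ →
            T4GenFunBounds.schemeZ ((datumOfRecord₁₃CoPH F N θ hP).scheme g₀) os ((crOfRecord₁₃VAt K₀ (jc F θ hP g₀ os) sh F θ hP g₀ os).K₀ + K + 1) t =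
              ∑ τ ∈ (crOfRecord₁₃VAt K₀ (jc F θ hP g₀ os) sh F θ hP g₀ os).T K, (crOfRecord₁₃VAt K₀ (jc F θ hP g₀ os) sh F θ hP g₀ os).B K t τ))
    (F : T4Family) (θ : Stage13HParams F N) (hP : θ.Provisos₁₃CoPH F N) (hG : G θ) (hθ : θ.Admissible F N) :
    HybridNE7Under (datumOfRecord₁₃CoPH F N θ hP) (DagBinding.EndpointExistence (datumOfRecord₁₃CoPH F N θ hP).C.toB12) :=
  keyedGuarded₁₃CoPH_of_fscCoreEdgeHolderD4_betaWindowPos (fun F θ hP g₀ os => crOfRecord₁₃VAt K₀ (jc F θ hP g₀ os) sh F θ hP g₀ os) G 𝔯 ks h20 h21 hrates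
    (fun F θ hP hG hθ _ _ _ hγ₀ hb0 hβ =>
      forSmallCouplings_keyedCoreEdgeHolderD4_crOfRecord₁₃VAt_of_linkReadingAtRunsAlong K₀ jc sh 𝔯 G hβ1 hlink ks F θ hP hG hθ hγ₀ hb0 hβ)
    hβw hx F θ hP hG hθ

end AtRunsAlongV

end Summit.QuantumFields.YangMills.BalabanUVNodes.N19RateEdgeHolderD4AtRunsAlongV

end
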